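import Mathlib.Algebra.MvPolynomial.Degrees
import Mathlib.Analysis.SpecialFunctions.Exp
import Mathlib.Analysis.SpecialFunctions.Trigonometric.Basic
import Mathlib.LinearAlgebra.LinearIndependent.Defs
import HarnessLib

/-!
# The zero lemma of Diaz 1989 (exponential polynomials in one variable at the points `μ.v`)

Topic `Literature/NumberTheory/Transcendental` (trunk T-TRANSCEND). Decomposition step for the
named fact `Literature.NumberTheory.Transcendental.Diaz1989_thm1` (`DiazMain.lean`): the second deep input of Diaz's
proof (after Philippon's criterion, `Philippon1986_mainCriterion`) is a zero lemma for polynomials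
in `z, e^{u₁z}, …, e^{u_nz}` at the points `μ₁v₁ + ⋯ + μ_mv_m`, in the *perturbed* form needed
for the criterion (the point `θ` is moved inside a small ball). Diaz states it on pp. 11–12 of
J. Number Theory 31 (1989) as a consequence of Philippon's zero estimate on commutative algebraic
groups (Bull. Soc. Math. France 114 (1986) 355–383), "adapté à la situation présente par
M. Waldschmidt ([15], Lemme 2.1)" ([15] = *Lemmes de zéros pour les polynômes exponentiels*,
Séminaire d'arithmétique de Saint-Étienne 1986–87). We vendor the printed statement as the named
fact `Diaz1989_zeroLemma`; its discharge from `Literature.NumberTheory.Transcendental.Philippon1986_GaGm`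
(`PhilipponZeroEstimate.lean`, which at present drops the degree bound on the obstructing subgroup
that the size estimates (12) require) is left to a sequel.

Printed statement (Diaz 1989, pp. 11–12, verbatim up to notation; `|λ| = max |λᵢ|`,
`λ.u = ∑ λᵢuᵢ`, `ℕ^m(S+1) = {μ ∈ ℕ^m ; |μ| < S + 1}`, `W = (W₀, W₁, …, W_n)`).

LEMME DE ZÉROS. Soient `n ≥ 1`, `m ≥ 2` des entiers ; `S, V, D₀, D₁, Δ` des réels positifs. Soient
`u₁, …, u_n` et `v₁, …, v_m` deux familles de nombres complexes linéairement indépendants sur `ℚ` ;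
et `θ_k`, `z_hk` (`1 ≤ h ≤ n`, `1 ≤ k ≤ m`) des nombres complexes vérifiant
(10) `∑_h ∑_k |z_hk - u_hv_k| < e^{-V}`, `∑_k |θ_k - v_k| < e^{-V}`,
`max(∑_h ∑_k |z_hk| ; π|u₁| ; π) ≤ Δ`.
Soit `P ∈ ℂ[W]` non nul de degré `≤ D₀` en `W₀`, et de degrés partiels `≤ D₁` en les autres
variables, vérifiant pour tout `μ ∈ ℕ^m(S + 1)` :
`P(∑_k μ_kθ_k, ∏_k e^{z_1k μ_k}, …, ∏_k e^{z_nk μ_k}) = 0`.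
Alors si on a (11) `D₀ ≥ 1`, `D₁ ≥ 1`, `(n+1)! D₀D₁ⁿ < (S/(n+1))^m` et `(n+1)D₁ < (S/(n+1))^{m-1}`,
il existe `λ ∈ ℤⁿ`, `μ ∈ ℤ^m` (`λ ≠ 0`, `μ ≠ 0`) vérifiant (12)
`|λ| ≤ c(n) Δ D₁² (S/(n+1))`, `|μ| ≤ c(n) Δ D₁ (S/(n+1))²`,
`|λ.u| × |μ.v| ≤ c(n) Δ D₁² (S/(n+1))² e^{-V}`,
où `c(n)` ne dépend que de `n` (on peut prendre `c(n) = n³`).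

Encodings. `P : MvPolynomial (Fin (n+1)) ℂ` with index `0` for `W₀` and `h.succ` for `W_h`
(the convention of `Literature.NumberTheory.Transcendental.GaGm`), partial degrees via `MvPolynomial.degreeOf`, the points
as `Fin.cons (∑ μ_kθ_k) (h ↦ ∏_k e^{z_hk μ_k})`, `μ ∈ ℕ^m(S+1)` as `μ : Fin m → ℕ` with
`∀ k, μ_k < S + 1`; the constant is existential, depending on `n` only ("on peut prendre
`c(n) = n³`" makes `∃ c` a consequence of the printed lemma). Nothing is asserted; users take
`(h : Diaz1989_zeroLemma)`.

## References

* G. Diaz, *Grands degrés de transcendance pour des familles d'exponentielles*, J. Number Theory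
  31 (1989), 1–23, §II-3-4, Lemme de zéros, pp. 11–12.
* P. Philippon, *Lemmes de zéros dans les groupes algébriques commutatifs*, Bull. Soc. Math.
  France 114 (1986), 355–383 (the zero estimate behind it).
-/

noncomputable section

open Finset

namespace Literature.NumberTheory.Transcendental

/-- **The zero lemma of Diaz 1989** (§II-3-4, pp. 11–12; from Philippon's zero estimate, adapted
by Waldschmidt): for `n ≥ 1` there is `c = c(n) > 0` such that for `m ≥ 2`, positive reals
`S, V, D₀, D₁, Δ`, `ℚ`-linearly independent `u ∈ ℂⁿ`, `v ∈ ℂ^m`, complex `θ_k, z_hk` with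
`∑|z_hk - u_hv_k| < e^{-V}`, `∑|θ_k - v_k| < e^{-V}`, `max(∑|z_hk|, π|u₁|, π) ≤ Δ`, and a non-zero
`P ∈ ℂ[W₀, …, W_n]` with `deg_{W₀} P ≤ D₀`, `deg_{W_h} P ≤ D₁`, vanishing at
`(∑ μ_kθ_k, ∏ e^{z_1kμ_k}, …, ∏ e^{z_nkμ_k})` for all `μ ∈ ℕ^m` with `max μ_k < S + 1`: if
`D₀, D₁ ≥ 1`, `(n+1)! D₀D₁ⁿ < (S/(n+1))^m` and `(n+1)D₁ < (S/(n+1))^{m-1}`, then there are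
`λ ∈ ℤⁿ ∖ 0`, `μ ∈ ℤ^m ∖ 0` with `|λ| ≤ cΔD₁²S/(n+1)`, `|μ| ≤ cΔD₁(S/(n+1))²` and
`|λ.u|·|μ.v| ≤ cΔD₁²(S/(n+1))² e^{-V}`. Users take `(h : Diaz1989_zeroLemma)`.
[cite: Diaz1989, §II-3-4 Lemme de zéros, pp. 11–12] -/
def Diaz1989_zeroLemma : Prop :=
  ∀ (n : ℕ) (hn : 1 ≤ n), ∃ c : ℝ, 0 < c ∧
    ∀ (m : ℕ), 2 ≤ m →
    ∀ (S V D₀ D₁ Δ : ℝ), 0 < S → 0 < V → 0 < D₀ → 0 < D₁ → 0 < Δ →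
    ∀ (u : Fin n → ℂ) (v : Fin m → ℂ), LinearIndependent ℚ u → LinearIndependent ℚ v →
    ∀ (θ : Fin m → ℂ) (z : Fin n → Fin m → ℂ),
      (∑ h, ∑ k, ‖z h k - u h * v k‖) < Real.exp (-V) →
      (∑ k, ‖θ k - v k‖) < Real.exp (-V) →
      (∑ h, ∑ k, ‖z h k‖) ≤ Δ → Real.pi * ‖u ⟨0, hn⟩‖ ≤ Δ → Real.pi ≤ Δ →
    ∀ (P : MvPolynomial (Fin (n + 1)) ℂ), P ≠ 0 →
      (P.degreeOf 0 : ℝ) ≤ D₀ → (∀ h : Fin n, (P.degreeOf h.succ : ℝ) ≤ D₁) →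
      (∀ μ : Fin m → ℕ, (∀ k, (μ k : ℝ) < S + 1) →
        MvPolynomial.eval (Fin.cons (∑ k, (μ k : ℂ) * θ k)
          (fun h => ∏ k, Complex.exp (z h k * (μ k : ℂ)))) P = 0) →
      1 ≤ D₀ → 1 ≤ D₁ →
      ((n + 1).factorial : ℝ) * D₀ * D₁ ^ n < (S / (n + 1)) ^ m →
      (n + 1 : ℝ) * D₁ < (S / (n + 1)) ^ (m - 1) →
      ∃ (lam : Fin n → ℤ) (mu : Fin m → ℤ), lam ≠ 0 ∧ mu ≠ 0 ∧
        (∀ i, (|lam i| : ℝ) ≤ c * Δ * D₁ ^ 2 * (S / (n + 1))) ∧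
        (∀ k, (|mu k| : ℝ) ≤ c * Δ * D₁ * (S / (n + 1)) ^ 2) ∧
        ‖∑ i, (lam i : ℂ) * u i‖ * ‖∑ k, (mu k : ℂ) * v k‖ ≤
          c * Δ * D₁ ^ 2 * (S / (n + 1)) ^ 2 * Real.exp (-V)

end Literature.NumberTheory.Transcendental

end
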